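import Summits.CriticalPhenomena.Ising3DConformalLimit.Theses.LocalisationClock
import Summits.CriticalPhenomena.Ising3DConformalLimit.Cruxes.ImryMaWindowNoise.Ideate2Sketch
import HarnessLib

/-!
# Summit-strength certificate (strategist r1) — `LocalisationClock.ImryMaWindowNoise` (stmt-CriticalPhenomena-15883)

Kernel-checked statement of the census verdict "crux ≡ Target modulo general lemmas":

* `EarlyEdge` — the uniform small-SNR LOWER asymptotics of the accumulated kurtosis deficit
  `D_L(s) = 3P_s[m²]² − P_s[m⁴]` (= `−6∫₀ˢ Cov(r_u,m_u²) du` by the clock calculus), stated directly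
  against the route Target's block coupling `g_L = (3σ_L⁴ − ⟨M_L⁴⟩)/σ_L⁴`:
  `D_L(s) ≥ κ·g_L·q·P_s[m²]²` while the clock level `q = P_s[m²]/σ_L²` is `≤ a₀`, uniformly in `L ≥ L₀`.
  Perturbatively `D/P[m²]² = 4ĝ_L q (1 + O_L(q))` with `ĝ_L = σ_L²|U₄(G𝟙,𝟙,G𝟙,G𝟙)|/‖G𝟙‖⁶ ∈ [64⁻⁶,64⁶]·g_L`
  (Lebowitz pointwise + MMS doubling), so `EarlyEdge` = (uniform second-order remainder) ∧ (comparability):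
  a Gaussian-side statement (upper bounds on posterior sixth-order terms), no non-triviality content.
* `earlyDeficit_of_target : EarlyEdge → Target → Sig.EarlyDeficit` (pure real arithmetic).
* `ImryMaWindowNoise_of_target : KurtosisRatchet → EarlyEdge → RateNonneg → Target → ImryMaWindowNoise`.
* `ImryMaWindowNoise_iff_target` : given the route's own rank-2 crux `LocalisationGHS` and support
  `TargetOfClock` (direction ⇒) and the general lemmas `KurtosisRatchet`, `EarlyEdge`, `RateNonneg`
  (direction ⇐), the crux is EQUIVALENT to the route's Target (block form of clause (iii)).

Nothing here is a line: the only ℤ³-specific hypothesis in either direction is `Target` itself.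
-/

noncomputable section

namespace Summit.CriticalPhenomena.Ising3DConformalLimit.Cruxes.ImryMaWindowNoise.SummitStrength

open scoped BigOperators Topology Manifold Classical MeasureTheory ProbabilityTheory Matrix InnerProductSpace ComplexConjugate ContinuousMap
open Filter Set Function TopologicalSpace MeasureTheory
open Summit.CriticalPhenomena.Ising3DConformalLimit.Theses.LocalisationClock
open Summit.CriticalPhenomena.Ising3DConformalLimit.Cruxes.ImryMaWindowNoise.Ideate2

/-- EARLY EDGE (uniform small-SNR lower asymptotics of the kurtosis deficit, against the Target's `g_L`):
`∃ a₀ κ > 0 ∃ L₀ ∀ L ≥ L₀, 0 < σ_L² ∧ ∀ s ≥ 0, P_s[m²] ≤ a₀σ_L² → κ·g_L·P_s[m²]·P_s[m²]² ≤ σ_L²·(3P_s[m²]² − P_s[m⁴])`,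
i.e. `D_L(s)/P_s[m²]² ≥ κ g_L q_L(s)` on `q ≤ a₀`. [folklore] -/
def EarlyEdge : Prop :=
  let βc : ℝ := Literature.Probability.LatticeModels.criticalBeta 3; let w : (L : ℕ) → (↥(Literature.Probability.LatticeModels.box 3 L) → ℤˣ) → ℝ := fun L τ => Literature.Probability.LatticeModels.plusExpect 3 βc 0 (fun σ => if (∀ x : ↥(Literature.Probability.LatticeModels.box 3 L), σ x = τ x) then 1 else 0); let tilt : (L : ℕ) → (↥(Literature.Probability.LatticeModels.box 3 L) → ℝ) → ((↥(Literature.Probability.LatticeModels.box 3 L) → ℤˣ) → ℝ) → ℝ := fun L y g => (∑ τ, w L τ * g τ * Real.exp (∑ x, y x * ((τ x : ℤ) : ℝ))) / (∑ τ, w L τ * Real.exp (∑ x, y x * ((τ x : ℤ) : ℝ))); let m : (L : ℕ) → (↥(Literature.Probability.LatticeModels.box 3 L) → ℝ) → ℝ := fun L y => tilt L y (fun τ => ∑ x, ((τ x : ℤ) : ℝ)); let Af : (L : ℕ) → (↥(Literature.Probability.LatticeModels.box 3 L) → ℝ) → ↥(Literature.Probability.LatticeModels.box 3 L) → ℝ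 := fun L y x => tilt L y (fun τ => ((τ x : ℤ) : ℝ) * ∑ x', ((τ x' : ℤ) : ℝ)) - tilt L y (fun τ => ((τ x : ℤ) : ℝ)) * m L y; let r : (L : ℕ) → (↥(Literature.Probability.LatticeModels.box 3 L) → ℝ) → ℝ := fun L y => ∑ x, Af L y x ^ 2; let P : (L : ℕ) → ℝ → ((↥(Literature.Probability.LatticeModels.box 3 L) → ℝ) → ℝ) → ℝ := fun L s Φ => ∑ τ, w L τ * ∫ z, Φ (fun x => s * ((τ x : ℤ) : ℝ) + Real.sqrt s * z x) ∂(Measure.pi fun _ : ↥(Literature.Probability.LatticeModels.box 3 L) => ProbabilityTheory.gaussianReal 0 1); let σ2 : ℕ → ℝ := fun L => Literature.Probability.LatticeModels.plusExpect 3 βc 0 (fun σ => (∑ x ∈ Literature.Probability.LatticeModels.box 3 L, Literature.Probability.LatticeModels.spinAt x σ) ^ 2); let M4 : ℕ → ℝ := fun L => Literature.Probability.LatticeModels.plusExpect 3 βc 0 (fun σ => (∑ x ∈ Literature.Probability.LatticeModels.box 3 L, Literature.Probability.LatticeModels.spinAt x σ) ^ 4); ∃ a₀ κ : ℝ, 0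 < a₀ ∧ 0 < κ ∧ ∃ L₀ : ℕ, ∀ L ≥ L₀, 0 < σ2 L ∧ ∀ s : ℝ, 0 ≤ s → P L s (fun y => m L y ^ 2) ≤ a₀ * σ2 L → κ * ((3 * σ2 L ^ 2 - M4 L) / σ2 L ^ 2) * P L s (fun y => m L y ^ 2) * P L s (fun y => m L y ^ 2) ^ 2 ≤ σ2 L * (3 * P L s (fun y => m L y ^ 2) ^ 2 - P L s (fun y => m L y ^ 4))

/-- Real-arithmetic core: from `κ g Pm·Pm² ≤ σ(3Pm² − P4)`, `g ≥ cT > 0`, `Pm ≥ aσ`, `σ, κ, a > 0`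
conclude the early deficit `3(κ cT a/3)Pm² ≤ 3Pm² − P4`. [folklore] -/
theorem early_core {Pm P4 σ g κ cT a : ℝ}
    (hkey : κ * g * Pm * Pm ^ 2 ≤ σ * (3 * Pm ^ 2 - P4)) (hg : cT ≤ g) (hσ : 0 < σ) (hκ : 0 < κ)
    (hcT : 0 < cT) (ha : 0 < a) (h1 : a * σ ≤ Pm) :
    3 * (κ * cT * a / 3) * Pm ^ 2 ≤ 3 * Pm ^ 2 - P4 := by
  have haσ : 0 < a * σ := mul_pos ha hσ
  have hg0 : 0 ≤ g := hcT.le.trans hg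
  have h2 : cT * (a * σ) ≤ g * Pm := mul_le_mul hg h1 haσ.le hg0
  have hPm2 : 0 ≤ Pm ^ 2 := sq_nonneg Pm
  have h3 : κ * (cT * (a * σ)) * Pm ^ 2 ≤ κ * (g * Pm) * Pm ^ 2 :=
    mul_le_mul_of_nonneg_right (mul_le_mul_of_nonneg_left h2 hκ.le) hPm2
  have h4 : κ * (g * Pm) * Pm ^ 2 = κ * g * Pm * Pm ^ 2 := by ring
  have h5 : σ * (κ * cT * a * Pm ^ 2) ≤ σ * (3 * Pm ^ 2 - P4) := by
    have : σ * (κ * cT * a * Pm ^ 2) = κ * (cT * (a * σ)) * Pm ^ 2 := by ring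
    rw [this]; exact h3.trans (h4 ▸ hkey)
  have h6 : κ * cT * a * Pm ^ 2 ≤ 3 * Pm ^ 2 - P4 := le_of_mul_le_mul_left h5 hσ
  have h7 : 3 * (κ * cT * a / 3) * Pm ^ 2 = κ * cT * a * Pm ^ 2 := by ring
  rw [h7]; exact h6

/-- Target-side ⇒ early deficit: below every level `b₀` the window `[b/2, b]`, `b = min a₀ b₀`, carries
`D ≥ 3c·P[m²]²` with `c = κ·c_T·(b/2)/3`. [folklore] -/
theorem earlyDeficit_of_target (hE : EarlyEdge) (hT : Target) : Sig.EarlyDeficit := by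
  obtain ⟨cT, hcT, LT, HT⟩ := hT
  obtain ⟨a₀, κ, ha₀, hκ, LE, HE⟩ := hE
  unfold Sig.EarlyDeficit
  intro βc w tilt m Af r P σ2
  intro b₀ hb₀ hb₁
  have hbpos : 0 < min a₀ b₀ := lt_min ha₀ hb₀
  refine ⟨min a₀ b₀ / 2, min a₀ b₀, κ * cT * (min a₀ b₀ / 2) / 3, by positivity, by linarith,
    min_le_right _ _, by positivity, max LE LT, ?_⟩
  intro L hL
  have hLE : LE ≤ L := le_trans (le_max_left _ _) hL
  have hLT : LT ≤ L := le_trans (le_max_right _ _) hL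
  obtain ⟨hσ, HE'⟩ := HE L hLE
  refine ⟨hσ, ?_⟩
  intro s hs h1 h2
  have hq : P L s (fun y => m L y ^ 2) ≤ a₀ * σ2 L :=
    h2.trans (mul_le_mul_of_nonneg_right (min_le_left _ _) hσ.le)
  exact early_core (HE' s hs hq) (HT L hLT) hσ hκ hcT (by positivity) h1

/-- Direction ⇐ of the certificate: Target (with the general lemmas KR, EarlyEdge, RateNonneg) gives the crux. [folklore] -/
theorem ImryMaWindowNoise_of_target (hK : Sig.KurtosisRatchet) (hE : EarlyEdge) (hR : Sig.RateNonneg)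
    (hT : Target) : ImryMaWindowNoise :=
  ImryMaWindowNoise_of_ratchet hK (earlyDeficit_of_target hE hT) hR

/-- THE SUMMIT-STRENGTH CERTIFICATE. Modulo the route's own lower-rank items (`LocalisationGHS`, rank 2;
`TargetOfClock`, support) and three general/Gaussian-side lemmas (`KurtosisRatchet`, `EarlyEdge`,
`RateNonneg`), the crux `ImryMaWindowNoise` is equivalent to the route's `Target`
(block form of clause (iii) = non-triviality of the critical ℤ³ block spin). [folklore] -/
theorem ImryMaWindowNoise_iff_target (hK : Sig.KurtosisRatchet) (hE : EarlyEdge) (hR : Sig.RateNonneg)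
    (hGHS : LocalisationGHS) (hTC : TargetOfClock) : ImryMaWindowNoise ↔ Target :=
  ⟨fun h => hTC hGHS h, fun hT => ImryMaWindowNoise_of_target hK hE hR hT⟩

end Summit.CriticalPhenomena.Ising3DConformalLimit.Cruxes.ImryMaWindowNoise.SummitStrength

end
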